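import Summits.KontsevichZagierPeriods.KontsevichZagierPeriods.Theorems.RootDecompRationalCubeDichotomyNashMultiGenP06

/-! # `RootDecompRationalCubeDichotomyNashMultiGenP07` — part 7/16 of the mechanical ≤385-line split of `NashEtaleMultiGen.lean`
(split by the decomp-kz census seat for landing; mathematics unchanged; part 7 continues part 6). -/

open Set MvPolynomial Filter Topology
open Literature.NumberTheory.Transcendental (IsSemialgebraicFunOn)
open Literature.ModelTheory.ExponentialFields (IsSemialgebraic isSemialgebraic_setOf_eval_pos
  isSemialgebraic_setOf_eval_ne_zero)

namespace Summit.KontsevichZagierPeriods.RootDecompRationalCubeDichotomy.Rung29430.MultiGen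
open Summit.KontsevichZagierPeriods.KontsevichZagierPeriods.Theses.RootDecompRationalCubeDichotomy
  (NashEtaleCover NashEtaleLocal PiRationalisation)
open Summit.KontsevichZagierPeriods.RootDecompRationalCubeDichotomy.Rung29430.NashEtaleLocalGlue
  (local_of_simple nashEtaleCover_of_nashEtaleLocal nashEtaleLocal_zero)
open Summit.KontsevichZagierPeriods.RootDecompRationalCubeDichotomy.Rung29430.NashEtaleLocalOne
  (analyticOnNhd_aeval_snoc)
open Summit.KontsevichZagierPeriods.RootDecompRationalCubeDichotomy.RungEtale.Etale
  (piRationalisation_of_nashEtaleCover)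

noncomputable section

namespace Collapse

/-! ### Stage 1: the étale `ℚ[x]`-algebra `S' = ℚ[x][y, z]/(F, z·J − 1)` -/

section Algebra

variable (n k : ℕ)

/-- Base ring `R = ℚ[x₁..xₙ]`. -/
abbrev R := MvPolynomial (Fin n) ℚ
/-- Ambient ring `A = R[y₁..y_k, z]` (`castSucc i` = `yᵢ`, `last k` = `z`). -/
abbrev A := MvPolynomial (Fin (k + 1)) (R n)

/-- The substitution reading `ℚ[x, y]` inside `A`: `x_m ↦ C (X m)`, `y_i ↦ X (castSucc i)`. -/
def sub : Fin (n + k) → A n k :=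
  Fin.addCases (fun m => C (X m)) (fun i => X (Fin.castSucc i))

/-- Auxiliary step `sub_castAdd`. [bookkeeping] -/
@[simp] theorem sub_castAdd (m : Fin n) : sub n k (Fin.castAdd k m) = C (X m) := by
  simp [sub]

/-- Auxiliary step `sub_natAdd`. [bookkeeping] -/
@[simp] theorem sub_natAdd (i : Fin k) : sub n k (Fin.natAdd n i) = X (Fin.castSucc i) := by
  simp [sub]

/-- `rd : ℚ[x, y] →ₐ[ℚ] A`. -/
def rd : MvPolynomial (Fin (n + k)) ℚ →ₐ[ℚ] A n k := aeval (sub n k)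

variable {n k}

/-- Auxiliary step `rd_X`. [bookkeeping] -/
theorem rd_X (j : Fin (n + k)) : rd n k (X j) = sub n k j := aeval_X _ _

/-- Auxiliary step `rd_C`. [bookkeeping] -/
theorem rd_C (a : ℚ) : rd n k (C a) = C (C a) := by
  rw [rd, algHom_C]
  rfl

/-- Auxiliary step `castSucc_ne_last'`. [bookkeeping] -/
theorem castSucc_ne_last' (i : Fin k) : Fin.castSucc i ≠ Fin.last k := (Fin.castSucc_lt_last i).ne

/-- Auxiliary step `castAdd_ne_natAdd`. [bookkeeping] -/
theorem castAdd_ne_natAdd (m : Fin n) (i : Fin k) : Fin.castAdd k m ≠ Fin.natAdd n i := by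
  intro h
  have := congrArg Fin.val h
  simp only [Fin.val_castAdd, Fin.val_natAdd] at this
  omega

/-- Auxiliary step `natAdd_ne_natAdd`. [bookkeeping] -/
theorem natAdd_ne_natAdd {i i' : Fin k} (h : i' ≠ i) : Fin.natAdd n i' ≠ Fin.natAdd n i := by
  intro e
  apply h
  have := congrArg Fin.val e
  simp only [Fin.val_natAdd] at this
  exact Fin.ext (by omega)

/-- Auxiliary step `pderiv_last_sub`. [bookkeeping] -/
theorem pderiv_last_sub (j : Fin (n + k)) : pderiv (Fin.last k) (sub n k j) = 0 := by
  induction j using Fin.addCases with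
  | left m => rw [sub_castAdd, pderiv_C]
  | right i => rw [sub_natAdd, pderiv_X_of_ne (castSucc_ne_last' i)]

/-- Auxiliary step `pderiv_castSucc_sub`. [bookkeeping] -/
theorem pderiv_castSucc_sub (i : Fin k) (j : Fin (n + k)) :
    pderiv (Fin.castSucc i) (sub n k j) = rd n k (pderiv (Fin.natAdd n i) (X j)) := by
  induction j using Fin.addCases with
  | left m =>
    rw [sub_castAdd, pderiv_C, pderiv_X, Pi.single_apply, if_neg (castAdd_ne_natAdd m i), map_zero]
  | right i' =>
    by_cases h : i' = i
    · subst h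
      rw [sub_natAdd, pderiv_X_self, pderiv_X_self, map_one]
    · rw [sub_natAdd, pderiv_X, pderiv_X, Pi.single_apply, Pi.single_apply,
        if_neg (fun e => h (Fin.castSucc_injective _ e)), if_neg (natAdd_ne_natAdd h), map_zero]

/-- `∂/∂z` kills everything read from `ℚ[x, y]`. -/
theorem pderiv_last_rd (G : MvPolynomial (Fin (n + k)) ℚ) : pderiv (Fin.last k) (rd n k G) = 0 := by
  induction G using MvPolynomial.induction_on with
  | C a => rw [rd_C, pderiv_C]
  | add p q hp hq => rw [map_add, map_add, hp, hq, add_zero]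
  | mul_X p j hp =>
    rw [map_mul, rd_X, Derivation.leibniz, pderiv_last_sub, hp, smul_zero, smul_zero, add_zero]

/-- Chain rule: `∂/∂yᵢ ∘ rd = rd ∘ ∂/∂yᵢ`. -/
theorem pderiv_castSucc_rd (i : Fin k) (G : MvPolynomial (Fin (n + k)) ℚ) :
    pderiv (Fin.castSucc i) (rd n k G) = rd n k (pderiv (Fin.natAdd n i) G) := by
  induction G using MvPolynomial.induction_on with
  | C a => rw [rd_C, pderiv_C, pderiv_C, map_zero]
  | add p q hp hq => rw [map_add, map_add, hp, hq, map_add, map_add]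
  | mul_X p j hp =>
    rw [map_mul, rd_X, Derivation.leibniz, smul_eq_mul, smul_eq_mul, hp, pderiv_castSucc_sub,
      Derivation.leibniz, smul_eq_mul, smul_eq_mul, map_add, map_mul, map_mul, rd_X]

variable (n k) in
/-- The Jacobian polynomial `J = det (∂F_j/∂y_i)_{i,j} ∈ ℚ[x, y]`. -/
def Jpoly (F : Fin k → MvPolynomial (Fin (n + k)) ℚ) : MvPolynomial (Fin (n + k)) ℚ :=
  (Matrix.of fun i j : Fin k => pderiv (Fin.natAdd n i) (F j)).det

variable (F : Fin k → MvPolynomial (Fin (n + k)) ℚ)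

/-- `J` read in `A`. -/
def JA : A n k := rd n k (Jpoly n k F)

/-- The `k + 1` relations `F₁, …, F_k, z·J − 1`. -/
def rel : Fin (k + 1) → A n k :=
  fun j => Fin.lastCases (X (Fin.last k) * JA F - 1) (fun j' => rd n k (F j')) j

/-- Auxiliary step `rel_last`. [bookkeeping] -/
@[simp] theorem rel_last : rel F (Fin.last k) = X (Fin.last k) * JA F - 1 := by
  simp [rel]

/-- Auxiliary step `rel_castSucc`. [bookkeeping] -/
@[simp] theorem rel_castSucc (j : Fin k) : rel F (Fin.castSucc j) = rd n k (F j) := by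
  simp [rel]

/-- The étale algebra `S' = A / (F, zJ − 1)`. -/
abbrev S' := A n k ⧸ Ideal.span (Set.range (rel F))

/-- Auxiliary step `pderiv_last_JA`. [bookkeeping] -/
theorem pderiv_last_JA : pderiv (Fin.last k) (JA F) = 0 := pderiv_last_rd _

/-- Auxiliary step `pderiv_last_rel_last`. [bookkeeping] -/
theorem pderiv_last_rel_last : pderiv (Fin.last k) (rel F (Fin.last k)) = JA F := by
  rw [rel_last, map_sub, Derivation.leibniz, pderiv_last_JA, pderiv_X_self, smul_zero, zero_add,
    smul_eq_mul, mul_one, Derivation.map_one_eq_zero, sub_zero]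

/-- Auxiliary step `pderiv_last_rel_castSucc`. [bookkeeping] -/
theorem pderiv_last_rel_castSucc (j : Fin k) : pderiv (Fin.last k) (rel F (Fin.castSucc j)) = 0 := by
  rw [rel_castSucc, pderiv_last_rd]

/-- Auxiliary step `pderiv_castSucc_rel_castSucc`. [bookkeeping] -/
theorem pderiv_castSucc_rel_castSucc (i j : Fin k) :
    pderiv (Fin.castSucc i) (rel F (Fin.castSucc j)) = rd n k (pderiv (Fin.natAdd n i) (F j)) := by
  rw [rel_castSucc, pderiv_castSucc_rd]

/-- The naive pre-submersive presentation of `S'`. -/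
def preP : Algebra.PreSubmersivePresentation (R n) (S' F) (Fin (k + 1)) (Fin (k + 1)) :=
  Algebra.PreSubmersivePresentation.naive (v := rel F) id Function.injective_id

/-- Auxiliary step `jacobiMatrix_preP`. [bookkeeping] -/
theorem jacobiMatrix_preP (i j : Fin (k + 1)) : (preP F).jacobiMatrix i j = pderiv i (rel F j) :=
  Algebra.PreSubmersivePresentation.jacobiMatrix_apply _ i j

/-- Auxiliary step `jacobiMatrix_submatrix`. [bookkeeping] -/
theorem jacobiMatrix_submatrix :
    (preP F).jacobiMatrix.submatrix Fin.castSucc Fin.castSucc =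
      (rd n k).toRingHom.mapMatrix (Matrix.of fun i j : Fin k => pderiv (Fin.natAdd n i) (F j)) := by
  refine Matrix.ext fun i j => ?_
  rw [Matrix.submatrix_apply, jacobiMatrix_preP, pderiv_castSucc_rel_castSucc, RingHom.mapMatrix_apply,
    Matrix.map_apply, Matrix.of_apply]
  rfl

/-- The Jacobian of the presentation is `J²`. -/
theorem jacobiMatrix_det_preP : (preP F).jacobiMatrix.det = JA F * JA F := by
  rw [Matrix.det_succ_row _ (Fin.last k), Fin.sum_univ_castSucc]
  have h0 : ∀ j : Fin k, (-1 : A n k) ^ ((Fin.last k : ℕ) + (Fin.castSucc j : ℕ)) *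
      (preP F).jacobiMatrix (Fin.last k) (Fin.castSucc j) *
      ((preP F).jacobiMatrix.submatrix (Fin.last k).succAbove (Fin.castSucc j).succAbove).det = 0 := by
    intro j
    rw [jacobiMatrix_preP, pderiv_last_rel_castSucc, mul_zero, zero_mul]
  rw [Finset.sum_eq_zero (fun j _ => h0 j), zero_add, jacobiMatrix_preP, pderiv_last_rel_last,
    Fin.succAbove_last, jacobiMatrix_submatrix, ← RingHom.map_det, Fin.val_last,
    Even.neg_one_pow ⟨k, rfl⟩, one_mul]
  rfl

/-- `J` is a unit in `S'` (its inverse is `z`). -/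
theorem isUnit_mk_JA : IsUnit (Ideal.Quotient.mk (Ideal.span (Set.range (rel F))) (JA F)) := by
  refine IsUnit.of_mul_eq_one (Ideal.Quotient.mk _ (X (Fin.last k))) ?_
  rw [← map_mul, ← (Ideal.Quotient.mk _).map_one, Ideal.Quotient.eq]
  refine Ideal.subset_span ⟨Fin.last k, ?_⟩
  rw [rel_last]
  ring

/-- The submersive presentation of `S'`. -/
def subP : Algebra.SubmersivePresentation (R n) (S' F) (Fin (k + 1)) (Fin (k + 1)) where
  __ := preP F
  jacobian_isUnit := by
    rw [Algebra.PreSubmersivePresentation.jacobian_eq_jacobiMatrix_det, jacobiMatrix_det_preP,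
      map_mul]
    have h : algebraMap (preP F).Ring (S' F) = Ideal.Quotient.mk _ := rfl
    rw [h]
    exact (isUnit_mk_JA F).mul (isUnit_mk_JA F)

/-- Auxiliary step `etale_S'`. [bookkeeping] -/
theorem etale_S' : Algebra.Etale (R n) (S' F) := by
  have h0 : Algebra.IsStandardSmoothOfRelativeDimension 0 (R n) (S' F) :=
    (subP F).isStandardSmoothOfRelativeDimension (by
      simp [Algebra.Presentation.dimension])
  infer_instance

/-- Auxiliary step `finitePresentation_S'`. [bookkeeping] -/
theorem finitePresentation_S' : Algebra.FinitePresentation (R n) (S' F) :=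
  Algebra.FinitePresentation.quotient (Submodule.fg_span (Set.finite_range _))

end Algebra

/-! ### Stage 2: point characters -/

section Points

variable {n k : ℕ} {F : Fin k → MvPolynomial (Fin (n + k)) ℚ}

/-- Evaluation of `A = ℚ[x][y, z]` at `x`, `(y, z) = v`. -/
def evA (x : Fin n → ℝ) (v : Fin (k + 1) → ℝ) : A n k →ₐ[ℚ] ℝ :=
  MvPolynomial.aevalTower (MvPolynomial.aeval x : R n →ₐ[ℚ] ℝ) v

variable {x : Fin n → ℝ} {v : Fin (k + 1) → ℝ}

/-- Auxiliary step `evA_X`. [bookkeeping] -/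
@[simp] theorem evA_X (l : Fin (k + 1)) : evA x v (X l) = v l := MvPolynomial.aevalTower_X _ _ _

/-- Auxiliary step `evA_C`. [bookkeeping] -/
@[simp] theorem evA_C (r : R n) : evA x v (C r) = MvPolynomial.aeval x r :=
  MvPolynomial.aevalTower_C _ _ _

/-- Auxiliary step `evA_sub`. [bookkeeping] -/
theorem evA_sub (j : Fin (n + k)) :
    evA x v (sub n k j) = Fin.append x (fun i => v (Fin.castSucc i)) j := by
  induction j using Fin.addCases with
  | left m => rw [sub_castAdd, evA_C, aeval_X, Fin.append_left]
  | right i => rw [sub_natAdd, evA_X, Fin.append_right]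

/-- Auxiliary step `evA_rd`. [bookkeeping] -/
theorem evA_rd (G : MvPolynomial (Fin (n + k)) ℚ) :
    evA x v (rd n k G) = aeval (Fin.append x (fun i => v (Fin.castSucc i))) G := by
  have h : (fun i => evA x v (sub n k i)) = Fin.append x (fun i => v (Fin.castSucc i)) :=
    funext fun j => evA_sub j
  rw [rd, ← AlgHom.comp_apply, MvPolynomial.comp_aeval, h]

/-- Auxiliary step `evA_JA`. [bookkeeping] -/
theorem evA_JA : evA x v (JA F) =
    (Matrix.of fun i j : Fin k =>
      aeval (Fin.append x (fun i => v (Fin.castSucc i))) (pderiv (Fin.natAdd n i) (F j))).det := by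
  rw [JA, evA_rd, Jpoly, AlgHom.map_det]
  rfl

/-- The relations vanish at a point `(x, w, z)` with `F(x, w) = 0` and `z · J(x, w) = 1`. -/
theorem evA_vanishes {w : Fin k → ℝ} {z : ℝ}
    (hF : ∀ j, aeval (Fin.append x w) (F j) = 0)
    (hz : z * (Matrix.of fun i j : Fin k =>
      aeval (Fin.append x w) (pderiv (Fin.natAdd n i) (F j))).det = 1) :
    ∀ a ∈ Ideal.span (Set.range (rel F)), evA x (Fin.snoc w z) a = 0 := by
  have hw : (fun i => (Fin.snoc w z : Fin (k + 1) → ℝ) (Fin.castSucc i)) = w :=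
    funext fun i => by simp
  intro a ha
  have hle : Ideal.span (Set.range (rel F)) ≤ RingHom.ker (evA x (Fin.snoc w z)).toRingHom := by
    rw [Ideal.span_le]
    rintro _ ⟨j, rfl⟩
    rw [SetLike.mem_coe, RingHom.mem_ker, AlgHom.toRingHom_eq_coe, AlgHom.coe_toRingHom]
    refine Fin.lastCases ?_ (fun j' => ?_) j
    · rw [rel_last, map_sub, map_mul, evA_X, Fin.snoc_last, evA_JA, hw, map_one, hz, sub_self]
    · rw [rel_castSucc, evA_rd, hw, hF]
  exact hle ha

/-- The point character `S' → ℝ`. -/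
def chi (x : Fin n → ℝ) (v : Fin (k + 1) → ℝ)
    (hI : ∀ a ∈ Ideal.span (Set.range (rel F)), evA x v a = 0) : S' F →ₐ[ℚ] ℝ :=
  Ideal.Quotient.liftₐ _ (evA x v) hI

/-- Auxiliary step `chi_mk`. [bookkeeping] -/
theorem chi_mk (hI : ∀ a ∈ Ideal.span (Set.range (rel F)), evA x v a = 0) (a : A n k) :
    chi x v hI (Ideal.Quotient.mk _ a) = evA x v a := by
  rw [chi, Ideal.Quotient.liftₐ_apply, Ideal.Quotient.lift_mk]
  rfl

/-- Auxiliary step `chi_algebraMap`. [bookkeeping] -/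
theorem chi_algebraMap (hI : ∀ a ∈ Ideal.span (Set.range (rel F)), evA x v a = 0) (r : R n) :
    chi x v hI (algebraMap (R n) (S' F) r) = MvPolynomial.aeval x r := by
  rw [← Ideal.Quotient.mk_algebraMap, MvPolynomial.algebraMap_eq, chi_mk, evA_C]

end Points

/-! ### Stage 3: the collapse (`CollapseAt n` for every `n`) -/

section Main

open Set Filter Topology
open Literature.NumberTheory.Transcendental
open Literature.ModelTheory.ExponentialFields (IsSemialgebraic isSemialgebraic_setOf_eval_ne_zero
  isSemialgebraic_univ)

/-- `x ↦ a x / b x ^ m` is `ℚ`-semialgebraic when `a`, `b` are and `b ≠ 0` on `s`. -/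
theorem isSemialgebraicFunOn_div_pow {N : ℕ} {s : Set (Fin N → ℝ)} (hs : IsSemialgebraic ℚ s)
    {a b : (Fin N → ℝ) → ℝ} (ha : IsSemialgebraicFunOn ℚ s a) (hb : IsSemialgebraicFunOn ℚ s b)
    (hb0 : ∀ x ∈ s, b x ≠ 0) (m : ℕ) :
    IsSemialgebraicFunOn ℚ s (fun x => a x / b x ^ m) := by
  have hmap : IsSemialgebraicMapOn ℚ s (fun x => (![a x, b x] : Fin 2 → ℝ)) := by
    refine IsSemialgebraicMapOn.of_forall hs fun j => ?_
    fin_cases j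
    · simpa using ha
    · simpa using hb
  have ht : IsSemialgebraic ℚ
      {v : Fin 2 → ℝ | MvPolynomial.aeval v (X 1 ^ m : MvPolynomial (Fin 2) ℚ) ≠ 0} :=
    isSemialgebraic_setOf_eval_ne_zero _
  have hq := isSemialgebraicFunOn_aeval_div_aeval (k := ℚ) ht (X 0 : MvPolynomial (Fin 2) ℚ)
    (X 1 ^ m) (fun v hv => hv)
  have hc := IsSemialgebraicFunOn.comp_isSemialgebraicMapOn_holds hq hmap (fun x hx => by
    simpa using pow_ne_zero m (hb0 x hx))
  refine hc.congr fun x _ => ?_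
  simp

end Main
end Collapse
end
end Summit.KontsevichZagierPeriods.RootDecompRationalCubeDichotomy.Rung29430.MultiGen
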